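import Summits.HodgeConjecture.CorCM.Model.FourierOpInjective
import Summits.HodgeConjecture.CorCM.Model.FourierIntertwine
import Summits.HodgeConjecture.CorCM.Model.CorrespondenceAlgebraic
import Summits.HodgeConjecture.CorCM.Model.PoincareClass
import Summits.HodgeConjecture.CorCM.Model.DiagonalDegree
import Summits.HodgeConjecture.CorCM.Model.PullZeroOfDegreeOne
import HarnessLib

/-!
# COR-CM model layer, row M22 `Fact_algDuality`: the K-a ASSEMBLY

Cell `pub-hodgecm2` (COR-CM), seat b29 (K-a junction understudy, ROSTER RULING v3.3).  This file COMPOSES the landed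
pieces of row M22 of `BINDER-OWNERS.md` (F-1 option (ii): `Fact_algDuality` PROVED in the tree) into the shape of the
stage-1 fact `Universe.Fact_algDuality` (`CorCM/Geometry/Facts.lean` :251) at the variety level (`PicardCM.Var`), for
the Fourier-type operator `D z = Σ_c tr(z ∪ m₄(b∘c)) • m₄(y∘c) : H^{2(d-2)}(P; ℚ) → H⁴(P; ℚ)`, leaving as NAMED
HYPOTHESES exactly the inputs of the R2 → P junction (seat b26 part B):
* `b`, `y` — two bases of `H¹(P(ℂ); ℚ)` indexed by `Fin N` (`y` = the polar basis of a polarisation);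
* `halg` — the Fourier kernel `Σ_c pr₁^* m₄(b∘c) ∪ pr₂^* m₄(y∘c)` is rational algebraic of codimension `4` on `P × P`
  (K-b, b16: `Model.sum_pull_cupPowOne_cup_mem_ratAlgebraicClasses`, from `θ ∈ alg P 1` and `ℓ(θ) = Σ_a pr₁^*b_a ∪ pr₂^*y_a`);
* `hRos` — the ROSATI TENSOR IDENTITY `Σ_a f(b_a) ⊗ y_a = Σ_a b_a ⊗ g(y_a)` for every pair `(f, g)` of `ℚ`-endomorphisms
  of `H¹(P; ℚ)` acting through the four projections as `ι_i(a)`, resp. `ι_i(ā)` (input R2: the Rosati involution of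
  the polarisation induces complex conjugation; lit-milne g5 p232481 / lit-deligne g5 / b13 `RosatiDualForm` / b26);
and PROVES from the tree: (o) bijectivity (`bijective_of_eq_fourierSum`, b29), (i) `ratAlgebraicClasses_map_fourierSum_le`
(b17, K-c), (ii) `map_fourierSum_map_eq_smul_of_rosati` (b22) with the degree `N_{K/ℚ}(a)⁴` from `var_deg_diag` (model-1,
row M19), `Ma^*` an automorphism of `H¹` for `a ≠ 0` (determinant `N(a)⁴ ≠ 0` via Künneth in degree one), both sides
zero for `a = 0`.  Declarations (def-free): `eq_zero_of_comp_coprod₄` (and b14's `pull_eq_zero_of_pull_one_eq_zero` for `a = 0`),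
`exists_fourierSum_algDuality` (any abelian variety, degrees `2(d-2) → 4`), `var_algDuality` (the `Fact_algDuality`
shape for the product of the CM abelian varieties of four codes; the junction `universeOf_fact_algDuality` =
destructuring of `IsDiagAct`, filed with the model layer once `CorCM/Model/Universe.lean` is in the tree).

References: [Lieberman1968] D. Lieberman, Amer. J. Math. 90 (1968) 366–374; [Kleiman1968AlgebraicCycles] S. Kleiman,
*Algebraic cycles and the Weil conjectures* (1968) App. 2A; [Beauville1983FourierChow] A. Beauville, LNM 1016 (1983)
Prop. 1, and H. Lange, *Abelian Varieties over the Complex Numbers* (2023) §6.2.4; [MumfordAV1970] D. Mumford,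
*Abelian Varieties* (1970) §1, §20.
-/

noncomputable section

open CategoryTheory MonoidalCategory CartesianMonoidalCategory
open Literature.AlgebraicTopology.SingularHomology
open Literature.AlgebraicGeometry Literature.AlgebraicGeometry.Motives Literature.AlgebraicGeometry.HodgeTheory
open Literature.NumberTheory.Automorphic Literature.NumberTheory.Automorphic.PicardCM
open scoped TensorProduct

namespace Summit.HodgeConjecture.CorCM.Model

/-! ### Preliminaries -/

section Prelim

variable (A : AbelianVariety ℂ)

/-- The light trace `BettiUniverse.tr hX k` is injective in any degree `k` equal to the top degree `2n`
(`tr_top_injective`). [cite: VoisinHodgeI2002, §5.3.2 Thm. 5.30] -/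
theorem tr_injective_of_eq {n : ℕ} {X : SchemeOver ℂ} (hX : IsSmoothProjective n X) {k : ℕ} (hk : k = 2 * n) :
    Function.Injective (BettiUniverse.tr hX k) := by
  subst hk
  exact tr_top_injective hX

/-- An endomorphism vanishing on the four summands of a surjective four-fold sum `ψ₀ ⊕ ψ₁ ⊕ ψ₂ ⊕ ψ₃` (left-nested)
vanishes. [folklore] -/
theorem eq_zero_of_comp_coprod₄ {V₀ V₁ V₂ V₃ W U : Type*} [AddCommGroup V₀] [Module ℚ V₀] [AddCommGroup V₁]
    [Module ℚ V₁] [AddCommGroup V₂] [Module ℚ V₂] [AddCommGroup V₃] [Module ℚ V₃] [AddCommGroup W] [Module ℚ W]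
    [AddCommGroup U] [Module ℚ U] (ψ₀ : V₀ →ₗ[ℚ] W) (ψ₁ : V₁ →ₗ[ℚ] W) (ψ₂ : V₂ →ₗ[ℚ] W) (ψ₃ : V₃ →ₗ[ℚ] W)
    (hΨ : Function.Surjective (((ψ₀.coprod ψ₁).coprod ψ₂).coprod ψ₃)) (G : W →ₗ[ℚ] U) (h₀ : G ∘ₗ ψ₀ = 0)
    (h₁ : G ∘ₗ ψ₁ = 0) (h₂ : G ∘ₗ ψ₂ = 0) (h₃ : G ∘ₗ ψ₃ = 0) : G = 0 := by
  refine LinearMap.ext fun w ↦ ?_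
  obtain ⟨⟨⟨⟨v₀, v₁⟩, v₂⟩, v₃⟩, rfl⟩ := hΨ w
  have e₀ := LinearMap.congr_fun h₀ v₀
  have e₁ := LinearMap.congr_fun h₁ v₁
  have e₂ := LinearMap.congr_fun h₂ v₂
  have e₃ := LinearMap.congr_fun h₃ v₃
  rw [LinearMap.comp_apply, LinearMap.zero_apply] at e₀ e₁ e₂ e₃
  simp only [LinearMap.coprod_apply, map_add, e₀, e₁, e₂, e₃, add_zero, LinearMap.zero_apply]

end Prelim

/-! ### The three clauses for a Fourier-type operator in the degrees of `Fact_algDuality` -/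

section Core

variable (A : AbelianVariety ℂ)

/-- **The K-a assembly on an abelian variety.**  Let `A` be a complex abelian variety with a smooth-projective
witness `hX : IsSmoothProjective d A.X`, `3 ≤ d`; `b`, `y` bases of `H¹(A(ℂ); ℚ)` indexed by `Fin N` such that the
Fourier kernel `Σ_{c : Fin 4 → Fin N} pr₁^* m₄(b∘c) ∪ pr₂^* m₄(y∘c)` is a rational algebraic class of codimension `4`
on `A × A` (K-b).  Then the Fourier-type operator `D z = Σ_c tr(z ∪ m₄(b∘c)) • m₄(y∘c)`,
`H^{2(d-2)}(A(ℂ); ℚ) → H⁴(A(ℂ); ℚ)` (light trace in degree `2(d-2) + 2·2`), is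
(o) bijective (`bijective_of_eq_fourierSum`), (i) maps `alg A (d-2)` into `alg A 2`
(`ratAlgebraicClasses_map_fourierSum_le`), and (ii) satisfies `G^* ∘ D ∘ F^* = λ • D` for every pair of
endomorphisms `F`, `G` of the variety with `tr ∘ F^* = λ • tr`, `F^*` bijective on `H¹` and the Rosati tensor identity
`Σ_a F^* b_a ⊗ y_a = Σ_a b_a ⊗ G^* y_a` (`map_fourierSum_map_eq_smul_of_rosati`), while `G^* ∘ D ∘ F^* = 0` whenever
`F^* = 0` on `H¹`. [cite: Kleiman1968AlgebraicCycles, §2 Appendix 2A] [cite: Lieberman1968, Thm. 1] -/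
theorem exists_fourierSum_algDuality {d : ℕ} (hX : IsSmoothProjective d A.X) (hd : 3 ≤ d) {N : ℕ}
    (b y : Module.Basis (Fin N) ℚ (bettiCohomology A.X 1))
    (halg : (∑ c : Fin 4 → Fin N, bettiCup (two_mul 4).symm
        (BettiUniverse.pull (fst A.X A.X) 4 (cupPowOne ℚ (ComplexPoints A.X) 4 (fun p ↦ b (c p))))
        (BettiUniverse.pull (snd A.X A.X) 4 (cupPowOne ℚ (ComplexPoints A.X) 4 (fun p ↦ y (c p))))) ∈
      ratAlgebraicClasses (A.X ⊗ A.X) 4) :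
    ∃ D : bettiCohomology A.X (2 * (d - 2)) →ₗ[ℚ] bettiCohomology A.X 4,
      (∀ z, D z = ∑ c : Fin 4 → Fin N,
        BettiUniverse.tr hX (2 * (d - 2) + 2 * 2)
            (BettiUniverse.cup A.X (2 * (d - 2)) (2 * 2) z (cupPowOne ℚ (ComplexPoints A.X) 4 (fun p ↦ b (c p)))) •
          cupPowOne ℚ (ComplexPoints A.X) 4 (fun p ↦ y (c p))) ∧
      Function.Bijective D ∧
      (ratAlgebraicClasses A.X (d - 2)).map D ≤ ratAlgebraicClasses A.X 2 ∧
      (∀ (F G : A.X ⟶ A.X) (lam : ℚ),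
        BettiUniverse.tr hX (2 * (d - 2) + 2 * 2) ∘ₗ BettiUniverse.pull F (2 * (d - 2) + 2 * 2) =
          lam • BettiUniverse.tr hX (2 * (d - 2) + 2 * 2) →
        Function.Bijective (BettiUniverse.pull F 1) →
        ∑ a, BettiUniverse.pull F 1 (b a) ⊗ₜ[ℚ] y a = ∑ a, b a ⊗ₜ[ℚ] BettiUniverse.pull G 1 (y a) →
        BettiUniverse.pull G 4 ∘ₗ D ∘ₗ BettiUniverse.pull F (2 * (d - 2)) = lam • D) ∧
      (∀ (F G : A.X ⟶ A.X), BettiUniverse.pull F 1 = 0 →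
        BettiUniverse.pull G 4 ∘ₗ D ∘ₗ BettiUniverse.pull F (2 * (d - 2)) = 0) := by
  classical
  have hA : IsSmoothProjective A.dim A.X := AbelianVariety.isSmoothProjective_holds (A := A)
  have hdim : d = A.dim := dim_unique hX hA
  -- the operator, in the spelling of `CorrespondenceAlgebraic.ratAlgebraicClasses_map_fourierSum_le`
  let x : (Fin 4 → Fin N) → bettiCohomology A.X (2 * 2) := fun c ↦ cupPowOne ℚ (ComplexPoints A.X) 4 (fun p ↦ b (c p))
  let y' : (Fin 4 → Fin N) → bettiCohomology A.X (2 * 2) := fun c ↦ cupPowOne ℚ (ComplexPoints A.X) 4 (fun p ↦ y (c p))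
  let D : bettiCohomology A.X (2 * (d - 2)) →ₗ[ℚ] bettiCohomology A.X 4 :=
    ∑ c ∈ (Finset.univ : Finset (Fin 4 → Fin N)),
      (BettiUniverse.tr hX (2 * (d - 2) + 2 * 2) ∘ₗ (BettiUniverse.cup A.X (2 * (d - 2)) (2 * 2)).flip (x c)).smulRight
        (y' c)
  have hD : ∀ z, D z = ∑ c : Fin 4 → Fin N,
      BettiUniverse.tr hX (2 * (d - 2) + 2 * 2)
          (BettiUniverse.cup A.X (2 * (d - 2)) (2 * 2) z (cupPowOne ℚ (ComplexPoints A.X) 4 (fun p ↦ b (c p)))) •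
        cupPowOne ℚ (ComplexPoints A.X) 4 (fun p ↦ y (c p)) := by
    intro z
    simp only [D, x, y', LinearMap.coe_sum, Finset.sum_apply, LinearMap.smulRight_apply, LinearMap.coe_comp,
      Function.comp_apply, LinearMap.flip_apply]
  refine ⟨D, hD, ?_, ?_, ?_, ?_⟩
  · -- (o) bijectivity
    exact bijective_of_eq_fourierSum A b y (i := 4) (j := 2 * (d - 2)) (m := 2 * (d - 2) + 2 * 2) rfl (by omega)
      (BettiUniverse.tr hX (2 * (d - 2) + 2 * 2)) (tr_injective_of_eq hX (by omega)) D hD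
  · -- (i) algebraic classes
    have hu : ofRatClass (ComplexPoints (A.X ⊗ A.X)) (2 * 2 + 2 * 2)
        (∑ c ∈ (Finset.univ : Finset (Fin 4 → Fin N)), BettiUniverse.cup (A.X ⊗ A.X) (2 * 2) (2 * 2)
          (BettiUniverse.pull (fst A.X A.X) (2 * 2) (x c)) (BettiUniverse.pull (snd A.X A.X) (2 * 2) (y' c))) ∈
        supportedClasses (A.X ⊗ A.X) (2 * 2 + 2 * 2) (2 + 2) := by
      rw [mem_ratAlgebraicClasses_iff] at halg
      exact halg
    exact ratAlgebraicClasses_map_fourierSum_le hX hX (p := d - 2) (j := 2) (s := 2) (by omega) Finset.univ x y' hu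
  · -- (ii) intertwining, `F^*` an automorphism of `H¹`
    intro F G lam hτ hF hRos
    refine LinearMap.ext fun z ↦ ?_
    let α : bettiCohomology A.X 1 ≃ₗ[ℚ] bettiCohomology A.X 1 := LinearEquiv.ofBijective (BettiUniverse.pull F 1) hF
    have h := map_fourierSum_map_eq_smul_of_rosati (R := ℚ) (Y := ComplexPoints A.X) (N := N) (i := 4)
      (j := 2 * (d - 2)) (k := 2 * (d - 2) + 2 * 2) rfl (BettiUniverse.tr hX (2 * (d - 2) + 2 * 2))
      (AlgPoints.mapContinuous (L := ℂ) F) (AlgPoints.mapContinuous (L := ℂ) G) lam hτ α (fun x ↦ rfl)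
      (fun a ↦ b a) (fun a ↦ y a) hRos z
    rw [LinearMap.smul_apply, LinearMap.comp_apply, LinearMap.comp_apply, hD, hD]
    exact h
  · -- (ii), degenerate case: `F^* = 0` on `H¹`, hence on `H^{2(d-2)}`
    intro F G hF
    have h0 : BettiUniverse.pull F (2 * (d - 2)) = 0 := pull_eq_zero_of_pull_one_eq_zero A F hF (by omega)
    rw [h0, LinearMap.comp_zero, LinearMap.comp_zero]

end Core

/-! ### `Fact_algDuality` on `PicardCM.Var` -/

section PicardCMVar

/-- `dim A_c ≥ 1` for the CM abelian variety of a code (`[E:ℚ]` is even and positive).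
[cite: MumfordAV1970, §1] -/
theorem one_le_finrank_div_two (c : CMCode) : 1 ≤ Module.finrank ℚ c.E / 2 := by
  have h := NumberField.IsTotallyComplex.finrank (K := c.E)
  have hpos : 0 < Module.finrank ℚ c.E := Module.finrank_pos
  omega

/-- **`Fact_algDuality` of the model universe** `universeOf hHD hI hU h₃` at the variety level, ASSEMBLED from the
landed kernels, modulo the R2 → P inputs.  For the left-nested product `P` of the CM abelian varieties `Var.cm (c i)`
of four codes (`K ≃+* (c i).E` abstract; the package takes `c i := cmCode K (Φ i)`, `e i := cmCodeEquiv K (Φ i)`),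
two bases `b`, `y` of `H¹(P(ℂ); ℚ)` with the Fourier kernel `Σ_c pr₁^* m₄(b∘c) ∪ pr₂^* m₄(y∘c)` rational algebraic
(`halg`, K-b) and the Rosati tensor identity for every pair of `ℚ`-endomorphisms of `H¹(P)` acting through the
projections as `ι_i(a)`, `ι_i(ā)` (`hRos`, R2): there is a `ℚ`-linear bijection `D : H^{2(dim P - 2)}(P; ℚ) → H⁴(P; ℚ)`
mapping `alg P (dim P - 2)` into `alg P 2` with `Mb^* ∘ D ∘ Ma^* = N_{K/ℚ}(a)⁴ • D` for all `Ma`, `Mb` acting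
diagonally by `a`, `ā` (the four `IsDiagAct` intertwinings, `pr4` unfolded, in every degree).
[cite: Lieberman1968, Thm. 1] [cite: Kleiman1968AlgebraicCycles, §2 Appendix 2A] -/
theorem var_algDuality (hHD : exists_isReal_hodgeModel) (hI : hodgePQ_independent_of_hodgeModel)
    (hU : BallQuotientUniformisedDatum) (h₃ : CMAbelianVarietyRealised) (c : Fin 4 → CMCode) {K : Type} [Field K]
    [NumberField K] [NumberField.IsCMField K] (e : (i : Fin 4) → (K ≃+* (c i).E)) {N : ℕ}
    (b y : Module.Basis (Fin N) ℚ
      (Var.Coh hU h₃ (Var.prod (Var.prod (Var.prod (.cm (c 0)) (.cm (c 1))) (.cm (c 2))) (.cm (c 3))) 1))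
    (halg : (∑ cc : Fin 4 → Fin N, bettiCup (two_mul 4).symm
        (BettiUniverse.pull
            (fst (Var.scheme hU h₃ (Var.prod (Var.prod (Var.prod (.cm (c 0)) (.cm (c 1))) (.cm (c 2))) (.cm (c 3))))
              (Var.scheme hU h₃ (Var.prod (Var.prod (Var.prod (.cm (c 0)) (.cm (c 1))) (.cm (c 2))) (.cm (c 3))))) 4
          (cupPowOne ℚ (ComplexPoints
            (Var.scheme hU h₃ (Var.prod (Var.prod (Var.prod (.cm (c 0)) (.cm (c 1))) (.cm (c 2))) (.cm (c 3))))) 4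
            (fun p ↦ b (cc p))))
        (BettiUniverse.pull
            (snd (Var.scheme hU h₃ (Var.prod (Var.prod (Var.prod (.cm (c 0)) (.cm (c 1))) (.cm (c 2))) (.cm (c 3))))
              (Var.scheme hU h₃ (Var.prod (Var.prod (Var.prod (.cm (c 0)) (.cm (c 1))) (.cm (c 2))) (.cm (c 3))))) 4
          (cupPowOne ℚ (ComplexPoints
            (Var.scheme hU h₃ (Var.prod (Var.prod (Var.prod (.cm (c 0)) (.cm (c 1))) (.cm (c 2))) (.cm (c 3))))) 4
            (fun p ↦ y (cc p))))) ∈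
      ratAlgebraicClasses
        (Var.scheme hU h₃ (Var.prod (Var.prod (Var.prod (.cm (c 0)) (.cm (c 1))) (.cm (c 2))) (.cm (c 3))) ⊗
          Var.scheme hU h₃ (Var.prod (Var.prod (Var.prod (.cm (c 0)) (.cm (c 1))) (.cm (c 2))) (.cm (c 3)))) 4)
    (hRos : ∀ (a : K)
      (f g : Var.Coh hU h₃ (Var.prod (Var.prod (Var.prod (.cm (c 0)) (.cm (c 1))) (.cm (c 2))) (.cm (c 3))) 1 →ₗ[ℚ]
        Var.Coh hU h₃ (Var.prod (Var.prod (Var.prod (.cm (c 0)) (.cm (c 1))) (.cm (c 2))) (.cm (c 3))) 1),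
      f ∘ₗ BettiUniverse.pull (Var.comp hU h₃ (Var.fst hU h₃ _ (.cm (c 3)))
          (Var.comp hU h₃ (Var.fst hU h₃ _ (.cm (c 2))) (Var.fst hU h₃ (.cm (c 0)) (.cm (c 1))))) 1 =
        BettiUniverse.pull (Var.comp hU h₃ (Var.fst hU h₃ _ (.cm (c 3)))
          (Var.comp hU h₃ (Var.fst hU h₃ _ (.cm (c 2))) (Var.fst hU h₃ (.cm (c 0)) (.cm (c 1))))) 1 ∘ₗ
          (BettiUniverse.cmEndAction ((cmRealisation h₃ (c 0)).θ.comp (e 0).toRingHom)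
            ((cmRealisation h₃ (c 0)).exists_map_comp (e 0)) hHD hI (Var.isSmoothProjective hU h₃ (.cm (c 0)))).ι a →
      f ∘ₗ BettiUniverse.pull (Var.comp hU h₃ (Var.fst hU h₃ _ (.cm (c 3)))
          (Var.comp hU h₃ (Var.fst hU h₃ _ (.cm (c 2))) (Var.snd hU h₃ (.cm (c 0)) (.cm (c 1))))) 1 =
        BettiUniverse.pull (Var.comp hU h₃ (Var.fst hU h₃ _ (.cm (c 3)))
          (Var.comp hU h₃ (Var.fst hU h₃ _ (.cm (c 2))) (Var.snd hU h₃ (.cm (c 0)) (.cm (c 1))))) 1 ∘ₗ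
          (BettiUniverse.cmEndAction ((cmRealisation h₃ (c 1)).θ.comp (e 1).toRingHom)
            ((cmRealisation h₃ (c 1)).exists_map_comp (e 1)) hHD hI (Var.isSmoothProjective hU h₃ (.cm (c 1)))).ι a →
      f ∘ₗ BettiUniverse.pull (Var.comp hU h₃ (Var.fst hU h₃ _ (.cm (c 3))) (Var.snd hU h₃ _ (.cm (c 2)))) 1 =
        BettiUniverse.pull (Var.comp hU h₃ (Var.fst hU h₃ _ (.cm (c 3))) (Var.snd hU h₃ _ (.cm (c 2)))) 1 ∘ₗ
          (BettiUniverse.cmEndAction ((cmRealisation h₃ (c 2)).θ.comp (e 2).toRingHom)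
            ((cmRealisation h₃ (c 2)).exists_map_comp (e 2)) hHD hI (Var.isSmoothProjective hU h₃ (.cm (c 2)))).ι a →
      f ∘ₗ BettiUniverse.pull (Var.snd hU h₃ _ (.cm (c 3))) 1 =
        BettiUniverse.pull (Var.snd hU h₃ _ (.cm (c 3))) 1 ∘ₗ
          (BettiUniverse.cmEndAction ((cmRealisation h₃ (c 3)).θ.comp (e 3).toRingHom)
            ((cmRealisation h₃ (c 3)).exists_map_comp (e 3)) hHD hI (Var.isSmoothProjective hU h₃ (.cm (c 3)))).ι a →
      g ∘ₗ BettiUniverse.pull (Var.comp hU h₃ (Var.fst hU h₃ _ (.cm (c 3)))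
          (Var.comp hU h₃ (Var.fst hU h₃ _ (.cm (c 2))) (Var.fst hU h₃ (.cm (c 0)) (.cm (c 1))))) 1 =
        BettiUniverse.pull (Var.comp hU h₃ (Var.fst hU h₃ _ (.cm (c 3)))
          (Var.comp hU h₃ (Var.fst hU h₃ _ (.cm (c 2))) (Var.fst hU h₃ (.cm (c 0)) (.cm (c 1))))) 1 ∘ₗ
          (BettiUniverse.cmEndAction ((cmRealisation h₃ (c 0)).θ.comp (e 0).toRingHom)
            ((cmRealisation h₃ (c 0)).exists_map_comp (e 0)) hHD hI (Var.isSmoothProjective hU h₃ (.cm (c 0)))).ι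
            (cmConjRingHom K a) →
      g ∘ₗ BettiUniverse.pull (Var.comp hU h₃ (Var.fst hU h₃ _ (.cm (c 3)))
          (Var.comp hU h₃ (Var.fst hU h₃ _ (.cm (c 2))) (Var.snd hU h₃ (.cm (c 0)) (.cm (c 1))))) 1 =
        BettiUniverse.pull (Var.comp hU h₃ (Var.fst hU h₃ _ (.cm (c 3)))
          (Var.comp hU h₃ (Var.fst hU h₃ _ (.cm (c 2))) (Var.snd hU h₃ (.cm (c 0)) (.cm (c 1))))) 1 ∘ₗ
          (BettiUniverse.cmEndAction ((cmRealisation h₃ (c 1)).θ.comp (e 1).toRingHom)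
            ((cmRealisation h₃ (c 1)).exists_map_comp (e 1)) hHD hI (Var.isSmoothProjective hU h₃ (.cm (c 1)))).ι
            (cmConjRingHom K a) →
      g ∘ₗ BettiUniverse.pull (Var.comp hU h₃ (Var.fst hU h₃ _ (.cm (c 3))) (Var.snd hU h₃ _ (.cm (c 2)))) 1 =
        BettiUniverse.pull (Var.comp hU h₃ (Var.fst hU h₃ _ (.cm (c 3))) (Var.snd hU h₃ _ (.cm (c 2)))) 1 ∘ₗ
          (BettiUniverse.cmEndAction ((cmRealisation h₃ (c 2)).θ.comp (e 2).toRingHom)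
            ((cmRealisation h₃ (c 2)).exists_map_comp (e 2)) hHD hI (Var.isSmoothProjective hU h₃ (.cm (c 2)))).ι
            (cmConjRingHom K a) →
      g ∘ₗ BettiUniverse.pull (Var.snd hU h₃ _ (.cm (c 3))) 1 =
        BettiUniverse.pull (Var.snd hU h₃ _ (.cm (c 3))) 1 ∘ₗ
          (BettiUniverse.cmEndAction ((cmRealisation h₃ (c 3)).θ.comp (e 3).toRingHom)
            ((cmRealisation h₃ (c 3)).exists_map_comp (e 3)) hHD hI (Var.isSmoothProjective hU h₃ (.cm (c 3)))).ι
            (cmConjRingHom K a) →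
      ∑ a', f (b a') ⊗ₜ[ℚ] y a' = ∑ a', b a' ⊗ₜ[ℚ] g (y a')) :
    ∃ D : Var.Coh hU h₃ (Var.prod (Var.prod (Var.prod (.cm (c 0)) (.cm (c 1))) (.cm (c 2))) (.cm (c 3)))
          (2 * (Var.dim (Var.prod (Var.prod (Var.prod (.cm (c 0)) (.cm (c 1))) (.cm (c 2))) (.cm (c 3))) - 2)) →ₗ[ℚ]
        Var.Coh hU h₃ (Var.prod (Var.prod (Var.prod (.cm (c 0)) (.cm (c 1))) (.cm (c 2))) (.cm (c 3))) 4,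
      Function.Bijective D ∧
      (Var.alg hU h₃ (Var.prod (Var.prod (Var.prod (.cm (c 0)) (.cm (c 1))) (.cm (c 2))) (.cm (c 3)))
          (Var.dim (Var.prod (Var.prod (Var.prod (.cm (c 0)) (.cm (c 1))) (.cm (c 2))) (.cm (c 3))) - 2)).map D ≤
        Var.alg hU h₃ (Var.prod (Var.prod (Var.prod (.cm (c 0)) (.cm (c 1))) (.cm (c 2))) (.cm (c 3))) 2 ∧
      ∀ (a : K)
        (Ma Mb : Var.Mor hU h₃ (Var.prod (Var.prod (Var.prod (.cm (c 0)) (.cm (c 1))) (.cm (c 2))) (.cm (c 3)))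
          (Var.prod (Var.prod (Var.prod (.cm (c 0)) (.cm (c 1))) (.cm (c 2))) (.cm (c 3))))
        (da db : (i : Fin 4) → Var.Mor hU h₃ (.cm (c i)) (.cm (c i))),
        (∀ i, BettiUniverse.pull (da i) 1 =
          (BettiUniverse.cmEndAction ((cmRealisation h₃ (c i)).θ.comp (e i).toRingHom)
            ((cmRealisation h₃ (c i)).exists_map_comp (e i)) hHD hI (Var.isSmoothProjective hU h₃ (.cm (c i)))).ι a) →
        (∀ k, BettiUniverse.pull Ma k ∘ₗ
            BettiUniverse.pull (Var.comp hU h₃ (Var.fst hU h₃ _ (.cm (c 3)))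
              (Var.comp hU h₃ (Var.fst hU h₃ _ (.cm (c 2))) (Var.fst hU h₃ (.cm (c 0)) (.cm (c 1))))) k =
          BettiUniverse.pull (Var.comp hU h₃ (Var.fst hU h₃ _ (.cm (c 3)))
              (Var.comp hU h₃ (Var.fst hU h₃ _ (.cm (c 2))) (Var.fst hU h₃ (.cm (c 0)) (.cm (c 1))))) k ∘ₗ
            BettiUniverse.pull (da 0) k) →
        (∀ k, BettiUniverse.pull Ma k ∘ₗ
            BettiUniverse.pull (Var.comp hU h₃ (Var.fst hU h₃ _ (.cm (c 3)))
              (Var.comp hU h₃ (Var.fst hU h₃ _ (.cm (c 2))) (Var.snd hU h₃ (.cm (c 0)) (.cm (c 1))))) k =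
          BettiUniverse.pull (Var.comp hU h₃ (Var.fst hU h₃ _ (.cm (c 3)))
              (Var.comp hU h₃ (Var.fst hU h₃ _ (.cm (c 2))) (Var.snd hU h₃ (.cm (c 0)) (.cm (c 1))))) k ∘ₗ
            BettiUniverse.pull (da 1) k) →
        (∀ k, BettiUniverse.pull Ma k ∘ₗ
            BettiUniverse.pull (Var.comp hU h₃ (Var.fst hU h₃ _ (.cm (c 3))) (Var.snd hU h₃ _ (.cm (c 2)))) k =
          BettiUniverse.pull (Var.comp hU h₃ (Var.fst hU h₃ _ (.cm (c 3))) (Var.snd hU h₃ _ (.cm (c 2)))) k ∘ₗ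
            BettiUniverse.pull (da 2) k) →
        (∀ k, BettiUniverse.pull Ma k ∘ₗ BettiUniverse.pull (Var.snd hU h₃ _ (.cm (c 3))) k =
          BettiUniverse.pull (Var.snd hU h₃ _ (.cm (c 3))) k ∘ₗ BettiUniverse.pull (da 3) k) →
        (∀ i, BettiUniverse.pull (db i) 1 =
          (BettiUniverse.cmEndAction ((cmRealisation h₃ (c i)).θ.comp (e i).toRingHom)
            ((cmRealisation h₃ (c i)).exists_map_comp (e i)) hHD hI (Var.isSmoothProjective hU h₃ (.cm (c i)))).ι
            (cmConjRingHom K a)) →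
        (∀ k, BettiUniverse.pull Mb k ∘ₗ
            BettiUniverse.pull (Var.comp hU h₃ (Var.fst hU h₃ _ (.cm (c 3)))
              (Var.comp hU h₃ (Var.fst hU h₃ _ (.cm (c 2))) (Var.fst hU h₃ (.cm (c 0)) (.cm (c 1))))) k =
          BettiUniverse.pull (Var.comp hU h₃ (Var.fst hU h₃ _ (.cm (c 3)))
              (Var.comp hU h₃ (Var.fst hU h₃ _ (.cm (c 2))) (Var.fst hU h₃ (.cm (c 0)) (.cm (c 1))))) k ∘ₗ
            BettiUniverse.pull (db 0) k) →
        (∀ k, BettiUniverse.pull Mb k ∘ₗ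
            BettiUniverse.pull (Var.comp hU h₃ (Var.fst hU h₃ _ (.cm (c 3)))
              (Var.comp hU h₃ (Var.fst hU h₃ _ (.cm (c 2))) (Var.snd hU h₃ (.cm (c 0)) (.cm (c 1))))) k =
          BettiUniverse.pull (Var.comp hU h₃ (Var.fst hU h₃ _ (.cm (c 3)))
              (Var.comp hU h₃ (Var.fst hU h₃ _ (.cm (c 2))) (Var.snd hU h₃ (.cm (c 0)) (.cm (c 1))))) k ∘ₗ
            BettiUniverse.pull (db 1) k) →
        (∀ k, BettiUniverse.pull Mb k ∘ₗ
            BettiUniverse.pull (Var.comp hU h₃ (Var.fst hU h₃ _ (.cm (c 3))) (Var.snd hU h₃ _ (.cm (c 2)))) k =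
          BettiUniverse.pull (Var.comp hU h₃ (Var.fst hU h₃ _ (.cm (c 3))) (Var.snd hU h₃ _ (.cm (c 2)))) k ∘ₗ
            BettiUniverse.pull (db 2) k) →
        (∀ k, BettiUniverse.pull Mb k ∘ₗ BettiUniverse.pull (Var.snd hU h₃ _ (.cm (c 3))) k =
          BettiUniverse.pull (Var.snd hU h₃ _ (.cm (c 3))) k ∘ₗ BettiUniverse.pull (db 3) k) →
        BettiUniverse.pull Mb 4 ∘ₗ D ∘ₗ BettiUniverse.pull Ma
            (2 * (Var.dim (Var.prod (Var.prod (Var.prod (.cm (c 0)) (.cm (c 1))) (.cm (c 2))) (.cm (c 3))) - 2)) =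
          ((Algebra.norm ℚ a) ^ 4) • D := by
  classical
  -- the product abelian variety whose underlying scheme is the model's scheme of `P` (definitionally)
  let B : AbelianVariety ℂ :=
    (((cmRealisation h₃ (c 0)).AV.prod (cmRealisation h₃ (c 1)).AV).prod (cmRealisation h₃ (c 2)).AV).prod
      (cmRealisation h₃ (c 3)).AV
  have hP : IsSmoothProjective (Var.dim (Var.prod (Var.prod (Var.prod (.cm (c 0)) (.cm (c 1))) (.cm (c 2))) (.cm (c 3))))
      B.X :=
    Var.isSmoothProjective hU h₃ (Var.prod (Var.prod (Var.prod (.cm (c 0)) (.cm (c 1))) (.cm (c 2))) (.cm (c 3)))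
  have hd : 3 ≤ Var.dim (Var.prod (Var.prod (Var.prod (.cm (c 0)) (.cm (c 1))) (.cm (c 2))) (.cm (c 3))) := by
    have h0 := one_le_finrank_div_two (c 0)
    have h1 := one_le_finrank_div_two (c 1)
    have h2 := one_le_finrank_div_two (c 2)
    have h3 := one_le_finrank_div_two (c 3)
    change 3 ≤ Module.finrank ℚ (c 0).E / 2 + Module.finrank ℚ (c 1).E / 2 + Module.finrank ℚ (c 2).E / 2 +
      Module.finrank ℚ (c 3).E / 2
    omega
  obtain ⟨D, hD, hbij, hmap, hii, hii0⟩ := exists_fourierSum_algDuality B hP hd b y halg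
  refine ⟨D, hbij, hmap, ?_⟩
  intro a Ma Mb da db hda hMa₀ hMa₁ hMa₂ hMa₃ hdb hMb₀ hMb₁ hMb₂ hMb₃
  -- Künneth in degree one for the four factors
  haveI i0 : Module.Finite ℚ (bettiCohomology (Var.scheme hU h₃ (.cm (c 0))) 1) := Var.finite hU h₃ _ 1
  haveI i1 : Module.Finite ℚ (bettiCohomology (Var.scheme hU h₃ (.cm (c 1))) 1) := Var.finite hU h₃ _ 1
  haveI i2 : Module.Finite ℚ (bettiCohomology (Var.scheme hU h₃ (.cm (c 2))) 1) := Var.finite hU h₃ _ 1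
  haveI i3 : Module.Finite ℚ (bettiCohomology (Var.scheme hU h₃ (.cm (c 3))) 1) := Var.finite hU h₃ _ 1
  haveI iP : Module.Finite ℚ
      (Var.Coh hU h₃ (Var.prod (Var.prod (Var.prod (.cm (c 0)) (.cm (c 1))) (.cm (c 2))) (.cm (c 3))) 1) :=
    Var.finite hU h₃ (Var.prod (Var.prod (Var.prod (.cm (c 0)) (.cm (c 1))) (.cm (c 2))) (.cm (c 3))) 1
  have hΨ := kunneth_one_bijective₄ (Var.isSmoothProjective hU h₃ (.cm (c 0)))
    (Var.isSmoothProjective hU h₃ (.cm (c 1))) (Var.isSmoothProjective hU h₃ (.cm (c 2)))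
    (Var.isSmoothProjective hU h₃ (.cm (c 3)))
  by_cases ha : a = 0
  · -- `a = 0`: `Ma^* = 0` on `H¹`, both sides vanish
    subst ha
    have hda0 : ∀ i, BettiUniverse.pull (da i) 1 = 0 := fun i ↦ by rw [hda i]; exact map_zero _
    have hMa1 : BettiUniverse.pull Ma 1 = 0 :=
      eq_zero_of_comp_coprod₄ _ _ _ _ hΨ.2 (BettiUniverse.pull Ma 1)
        ((hMa₀ 1).trans (by rw [hda0 0, LinearMap.comp_zero])) ((hMa₁ 1).trans (by rw [hda0 1, LinearMap.comp_zero]))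
        ((hMa₂ 1).trans (by rw [hda0 2, LinearMap.comp_zero])) ((hMa₃ 1).trans (by rw [hda0 3, LinearMap.comp_zero]))
    rw [Algebra.norm_zero, zero_pow four_ne_zero, zero_smul]
    exact hii0 Ma Mb hMa1
  · -- `a ≠ 0`: `Ma^*` is an automorphism of `H¹` of determinant `N(a)⁴ ≠ 0`
    have hτ := var_deg_diag hHD hI hU h₃ c e a Ma da hda (hMa₀ 1) (hMa₁ 1) (hMa₂ 1) (hMa₃ 1)
      (2 * (Var.dim (Var.prod (Var.prod (Var.prod (.cm (c 0)) (.cm (c 1))) (.cm (c 2))) (.cm (c 3))) - 2) + 2 * 2)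
    have hdet : ∀ i, LinearMap.det (BettiUniverse.pull (da i) 1) = Algebra.norm ℚ a := fun i ↦ by
      rw [hda i, BettiUniverse.cmEndAction_ι]
      exact det_eq_norm_of_algHom _ (finrank_H1_realisation h₃ (c i) (e i)) a
    have hdetM : LinearMap.det (BettiUniverse.pull Ma 1) = (Algebra.norm ℚ a) ^ 4 := by
      refine (det_eq_prod_of_coprod₄ _ _ _ _ hΨ (BettiUniverse.pull (da 0) 1) (BettiUniverse.pull (da 1) 1)
        (BettiUniverse.pull (da 2) 1) (BettiUniverse.pull (da 3) 1) (BettiUniverse.pull Ma 1)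
        (hMa₀ 1) (hMa₁ 1) (hMa₂ 1) (hMa₃ 1)).trans ?_
      rw [hdet 0, hdet 1, hdet 2, hdet 3]
      ring
    have hbijMa : Function.Bijective (BettiUniverse.pull Ma 1) := by
      refine (Module.End.isUnit_iff _).mp ((LinearMap.isUnit_iff_isUnit_det _).mpr ?_)
      rw [hdetM]
      exact isUnit_iff_ne_zero.mpr (pow_ne_zero 4 (Algebra.norm_ne_zero_iff.mpr ha))
    refine hii Ma Mb _ hτ hbijMa (hRos a (BettiUniverse.pull Ma 1) (BettiUniverse.pull Mb 1) ?_ ?_ ?_ ?_ ?_ ?_ ?_ ?_)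
    · exact (hMa₀ 1).trans (congrArg (fun t ↦ BettiUniverse.pull _ 1 ∘ₗ t) (hda 0))
    · exact (hMa₁ 1).trans (congrArg (fun t ↦ BettiUniverse.pull _ 1 ∘ₗ t) (hda 1))
    · exact (hMa₂ 1).trans (congrArg (fun t ↦ BettiUniverse.pull _ 1 ∘ₗ t) (hda 2))
    · exact (hMa₃ 1).trans (congrArg (fun t ↦ BettiUniverse.pull _ 1 ∘ₗ t) (hda 3))
    · exact (hMb₀ 1).trans (congrArg (fun t ↦ BettiUniverse.pull _ 1 ∘ₗ t) (hdb 0))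
    · exact (hMb₁ 1).trans (congrArg (fun t ↦ BettiUniverse.pull _ 1 ∘ₗ t) (hdb 1))
    · exact (hMb₂ 1).trans (congrArg (fun t ↦ BettiUniverse.pull _ 1 ∘ₗ t) (hdb 2))
    · exact (hMb₃ 1).trans (congrArg (fun t ↦ BettiUniverse.pull _ 1 ∘ₗ t) (hdb 3))

end PicardCMVar

end Summit.HodgeConjecture.CorCM.Model

end
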